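import Mathlib
import HarnessLib
import Summits.ValiantsHypothesis.ValiantsHypothesis.Theses.MonotoneRestoration
import Literature.Computability.AlgebraicComplexity.ArithCircuit
import Literature.Computability.AlgebraicComplexity.ArithCircuitProofs
import Literature.Computability.AlgebraicComplexity.MonotoneStructure
import Literature.Computability.AlgebraicComplexity.PermanentIrreducible
import Literature.ModelTheory.FiniteModelTheory.CkEquiv
import Summits.ValiantsHypothesis.ValiantsHypothesis.Theorems.MonotoneRestorationMonotoneRestorationQPCosetCount
import Summits.ValiantsHypothesis.ValiantsHypothesis.Theorems.MonotoneRestorationMonotoneRestorationQPSymmetricLB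
import Summits.ValiantsHypothesis.ValiantsHypothesis.Theorems.MonotoneRestorationMonotoneRestorationQPSupportSymmetrisation
import Summits.ValiantsHypothesis.ValiantsHypothesis.Theorems.MonotoneRestorationMonotoneRestorationQPSparseRegime
import Summits.ValiantsHypothesis.ValiantsHypothesis.Theorems.MonotoneRestorationMonotoneRestorationQPBeta
import Literature.Computability.AlgebraicComplexity.SymmetricArithCircuit
import Literature.Computability.AlgebraicComplexity.DawarWilsenach2025Proofs
import Literature.GroupTheory.PermutationGroups.SmallIndexSubgroups
import Summits.ValiantsHypothesis.ValiantsHypothesis.Theorems.MonotoneRestorationQP.Negative.LoadBearing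
import Summits.ValiantsHypothesis.ValiantsHypothesis.Theorems.MonotoneRestorationMonotoneRestorationQPPermSupportCount

/-! TTRL-lite variant V18963 of stmt-ValiantsHypothesis-15886 -/

-- `ValiantsHypothesis.ValiantsHypothesis`: the D-0017 layout repeats the problem name in the path.
set_option linter.dupNamespace false

namespace Summit.ValiantsHypothesis.ValiantsHypothesis.Theorems

open Summit.ValiantsHypothesis.ValiantsHypothesis.Theses.MonotoneRestoration
open Literature.Computability.AlgebraicComplexity

/-- TTRL-lite variant V18963 (`lemma_proposal`) of `stub_monotoneComputation_of_complexity`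
(stmt-ValiantsHypothesis-15886): the first `have` of the stub's proof — `complexity f` is
ATTAINED, i.e. some fan-in-two circuit of size exactly `complexity f` computes `f` (the defining
set of the `sInf` is nonempty, so there is no `sInf ∅ = 0` junk).  This is the tree lemma
`ArithCircuit.exists_computes_size_eq_complexity` (`ArithCircuitProofs.lean`) quantified over
`σ : Type`. [cite: Burgisser2000, Def. 2.1] -/
theorem stub_monotoneComputation_of_complexity_var18963 :
    ∀ (σ : Type) (f : MvPolynomial σ NNReal), ∃ P : ArithCircuit NNReal σ,
      P.IsFanInTwo ∧ P.Computes f ∧ P.size = complexity f :=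
  fun _σ f => ArithCircuit.exists_computes_size_eq_complexity f

end Summit.ValiantsHypothesis.ValiantsHypothesis.Theorems
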